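import Literature.MathematicalPhysics.QuantumFieldTheory.Balaban1983to89.B6Cov2110MatrixV1
import Literature.MathematicalPhysics.QuantumFieldTheory.Balaban1983to89.B6Ineq2122TwoScaleV1

/-!
# `Balaban1983to89.B6CovTildeMatrixV1` — T. Bałaban, *Propagators and renormalization transformations for lattice gauge
# theories. II*, Commun. Math. Phys. **96** (1984) 223–250 [Balaban1984PropagatorsII], p. 246 (text after (2.128)): *«This implies that a covariance
# C̃^{(j)}_Λ of the Gaussian integral in (2.119) is bounded from above by a positive constant dependent on d and L only, and it has an exponential
# decay with a decay rate having the same property»* — THE CONCRETE `C̃^{(j)}_Λ = covOp Ax (Q″*aQ″ + Δ_j)` OF THE TWO-SCALE DATA `tsV1` MEETS THE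
# HYPOTHESES OF THE COMPRESSED COMBES–THOMAS STEP: the projection onto the axial `B` is DIAGONAL in the bond basis, so its kernel decays
# exponentially AS SOON AS the conjugation-error (Schur) bound for the kernel of `Q″*aQ″ + Δ_j` under ANY weight on the bonds is supplied

statement-level skeleton of published theorems with citation tags; proofs where landed; nothing here is a claim about the Yang–Mills mass gap

PDF held: `paper:balaban1984-cmp96-propagators-rt-ii` (journal page = PDF page + 222; p. 246 [PDF 24] read AS IMAGE on the ×2 render
`run/shared/lean/pub/pub-balaban/b2b-balaban-ref1/pages/1984-cmp96-propagators-rt-II/…-p024-x2.png`, 2026-08-22).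

PRINT (verbatim, p. 246).  *"Another consequence is a bound from below for the form (2.120), or for the form (2.122). These forms are bounded from
below by γ₀″‖B‖² with a positive constant γ₀″ dependent on d and L only. This implies that a covariance C̃^{(j)}_Λ of the Gaussian integral in
(2.119) is bounded from above by a positive constant dependent on d and L only, and it has an exponential decay with a decay rate having the same
property."*

CITATION HEADER (lean-in-tree rule) — WHAT IS REPRODUCED.  Phase-2 file of the `lit-balaban` typed skeleton (HOME
`run/shared/lean/pub/lit-balaban/`), seat **p22 gen 12** (B6 fold owner r03, referee ref-4; lane = the Sect. C chain (2.95)–(2.147) on the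
concrete two-scale data `tsV1`).  SKELETON row **B6.Txt@246** (the «exponential decay» clause of the C̃-sentence; its «bounded from above» clause is
gen 11's `…B6Ineq2122TwoScaleV1.inner_Ct_le_V1`).  IMPORTS BY NAME: gen 11's abstract step `…B6Cov2110CombesThomas.cov_abs_le` and the generic
site-basis matrix algebra `…B6Cov2110MatrixV1.siteMatrix_mulVec/…_isSymm_of_symm/…_mul/compressed_mulVec_of_proj_eq`, gen 10's
`…B6Axial2121TwoScaleV1.starProjection_axial_eq` (the projection onto the axial `B` is the coordinate restriction off the centred tree bonds of
`B(Λ′)`), gen 11's `…B6Ineq2122TwoScaleV1.inner_Sb_ge_V1` ((2.120) `≥ min(w₀, κ)(481d⁶L^{2d+4})⁻¹` on `Ax`), gen 8's `…B6SectCPositivity.Sb_symm/Sb_pos`,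
gen 7's `B6CovarianceOperator.covOp_mem/covOp_sol` (`C̃^{(j)}_Λ = covOp Ax (Q″*aQ″ + Δ_j)`).  THIS FILE, for `tsV1 hc Λ′ w` (`c ≠ 0`, `j + 1 ≤ m + K`,
weights `w ≥ w₀ > 0`), `S̃ := M_{Q″*aQ″ + Δ_j}`, `P̃ := M_{P_{Ax}}` (bond basis of `ℓ²(T^{(j)})`):
* §1 **`projAxMatrix_apply`** (`P̃(b, b′) = [b = b′]·[b not a centred tree bond of B(Λ′)]` — DIAGONAL), `projAxMatrix_isSymm`, `projAxMatrix_idem`,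
  **`projAxMatrix_blockConst`** (EVERY weight `φ` on the bonds is constant on the blocks of `P̃`), `SbMatrix_isSymm`, **`SbMatrix_coercive`** (`hS` with
  `γ̃ = min(w₀, κ)(481d⁶L^{2d+4})⁻¹`, `κ = c²/(η^dL^{2j})`), **`covt_column_eq`** (the kernel column `c = C̃^{(j)}_Λe_{b′}` solves `(P̃S̃P̃ + γ̃(1 − P̃))c = P̃e_{b′}`);
* §2 **`covt_kernel_decay_of_herr`**: for every weight `φ` on the bonds whose conjugation error for `S̃` on `range P̃` is `≥ −(γ̃/2)‖·‖²` (`hSe`, the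
  Schur bound — NOT proved here), `|⟨e_b, C̃^{(j)}_Λe_{b′}⟩| ≤ (2/γ̃)·e^{−(φ(b) − φ(b′))}`.
THEOREMS ONLY (no definition, no `def … : Prop` fact); standard axioms.  HONEST SCOPE: CONDITIONAL on the displayed Schur bound `hSe` (successor file:
the kernel of `Δ_j` — `…B6DeltaJKernelTwoScaleV1.kernel_Δj_decay` — plus the finite-range kernel of `Q″*aQ″`, row sums, choice of the rate); `γ̃`
carries the V1 normalisation `κ` and the weight bound `w₀` (print: *"dependent on d and L only"* at `a = 1`, unit normalisation); finite tori of the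
V1 calculus, centred blocks (`L` odd); NOT summit progress.
-/

noncomputable section

open scoped InnerProductSpace
open Finset Matrix

namespace Literature.MathematicalPhysics.QuantumFieldTheory.Balaban1983to89.B6CovTildeMatrixV1

open LatticeFieldCalculus B6SectAOperatorsV1 B6SectCTwoScaleV1 B6SectCTwoScaleV1Lattice B6CovarianceOperator
open B6SectCOperators (TwoScaleData)
open B6SectCPositivity (Sb_symm Sb_pos)
open B5SectBStatements (eta)
open B6Axial2121TwoScaleV1 (IsCentredTreeBond starProjection_axial_eq)
open B6Ineq2122TwoScaleV1 (inner_Sb_ge_V1)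
open B6Cov2110MatrixV1 (siteMatrix_mulVec dotProduct_siteMatrix_mulVec siteMatrix_isSymm_of_symm siteMatrix_mul compressed_mulVec_of_proj_eq)
open B6Cov2110CombesThomas (cov_abs_le)

section V1

variable {P : Params} {c : ℝ} (hc : c ≠ 0) {j : ℕ} (hj : j + 1 ≤ P.m + P.K) (Λ' : Finset (Site P (j + 1)))
  {w : CIdx j Λ' → ℝ} (hw : ∀ i, 0 < w i) [DecidableEq (PBond P j)]

/-! ## §1  The matrices of `Q″*aQ″ + Δ_j` and of the (diagonal) projection onto the axial `B` -/

include hj in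
/-- **THE PROJECTION ONTO THE AXIAL `B` IS DIAGONAL IN THE BOND BASIS**: `P̃(b, b′) = 1` if `b = b′` is not a centred tree bond of `B(Λ′)`, `0` otherwise
(gen 10's `starProjection_axial_eq`). [cite: Balaban1984PropagatorsII, (2.146) p.248] -/
theorem projAxMatrix_apply (b b' : PBond P j) :
    Matrix.of (fun x x' : PBond P j => (axial P j Λ').starProjection (EuclideanSpace.single x' (1 : ℝ)) x) b b' =
      if b = b' ∧ ¬(blockOf b.src ∈ Λ' ∧ IsCentredTreeBond b) then 1 else 0 := by
  rw [Matrix.of_apply, starProjection_axial_eq Λ' hj, PiLp.toLp_apply, PiLp.single_apply]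
  by_cases ht : blockOf b.src ∈ Λ' ∧ IsCentredTreeBond b
  · rw [if_pos ht, if_neg (fun h => h.2 ht)]
  · rw [if_neg ht]
    by_cases hb : b = b'
    · rw [if_pos hb, if_pos ⟨hb, ht⟩]
    · rw [if_neg hb, if_neg (fun h => hb h.1)]

/-- the matrix of the projection onto the axial `B` is symmetric. [cite: Balaban1984PropagatorsII, (2.121) p.244] -/
theorem projAxMatrix_isSymm :
    (Matrix.of (fun x x' : PBond P j => (axial P j Λ').starProjection (EuclideanSpace.single x' (1 : ℝ)) x)).IsSymm :=
  siteMatrix_isSymm_of_symm ((axial P j Λ').starProjection : UBond P j →ₗ[ℝ] UBond P j)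
    fun a b => Submodule.inner_starProjection_left_eq_right (axial P j Λ') a b

/-- … and idempotent. [cite: Balaban1984PropagatorsII, (2.121) p.244] -/
theorem projAxMatrix_idem :
    Matrix.of (fun x x' : PBond P j => (axial P j Λ').starProjection (EuclideanSpace.single x' (1 : ℝ)) x) *
        Matrix.of (fun x x' : PBond P j => (axial P j Λ').starProjection (EuclideanSpace.single x' (1 : ℝ)) x) =
      Matrix.of (fun x x' : PBond P j => (axial P j Λ').starProjection (EuclideanSpace.single x' (1 : ℝ)) x) := by
  have h := siteMatrix_mul ((axial P j Λ').starProjection : UBond P j →ₗ[ℝ] UBond P j)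
    ((axial P j Λ').starProjection : UBond P j →ₗ[ℝ] UBond P j)
  simp only [ContinuousLinearMap.coe_coe] at h
  rw [h]
  ext x x'
  simp only [Matrix.of_apply, LinearMap.comp_apply, ContinuousLinearMap.coe_coe]
  rw [Submodule.starProjection_eq_self_iff.mpr (Submodule.starProjection_apply_mem _ _)]

include hj in
/-- **EVERY weight on the bonds is constant on the blocks of `P̃`** (the projection is diagonal: `P̃(b, b′) ≠ 0 ⇒ b = b′`).
[cite: Balaban1984PropagatorsII, (2.146) p.248] -/
theorem projAxMatrix_blockConst (φ : PBond P j → ℝ) (b b' : PBond P j)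
    (h : Matrix.of (fun x x' : PBond P j => (axial P j Λ').starProjection (EuclideanSpace.single x' (1 : ℝ)) x) b b' ≠ 0) : φ b = φ b' := by
  rw [projAxMatrix_apply hj Λ'] at h
  by_cases hb : b = b' ∧ ¬(blockOf b.src ∈ Λ' ∧ IsCentredTreeBond b)
  · rw [hb.1]
  · exact absurd (if_neg hb) h

include hj hw in
/-- the matrix of `Q″*aQ″ + Δ_j` is symmetric. [cite: Balaban1984PropagatorsII, (2.119)–(2.120) pp.243–244] -/
theorem SbMatrix_isSymm : (Matrix.of (fun x x' : PBond P j => (tsV1 hc Λ' w).Sb (EuclideanSpace.single x' (1 : ℝ)) x)).IsSymm :=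
  siteMatrix_isSymm_of_symm _ (Sb_symm (isLattice Λ' hc hj hw))

/-- `P_{Ax}(v) ∈ Ax` read through the matrices: `toLp (P̃v)` is axial. [cite: Balaban1984PropagatorsII, (2.121) p.244] -/
theorem toLp_projAxMatrix_mulVec (v : PBond P j → ℝ) :
    WithLp.toLp 2 (Matrix.of (fun x x' : PBond P j => (axial P j Λ').starProjection (EuclideanSpace.single x' (1 : ℝ)) x) *ᵥ v) =
      (axial P j Λ').starProjection (WithLp.toLp 2 v) := by
  ext x
  rw [PiLp.toLp_apply]
  exact siteMatrix_mulVec ((axial P j Λ').starProjection : UBond P j →ₗ[ℝ] UBond P j) v x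

include hj hw in
/-- **COERCIVITY ON `range P̃`** (hypothesis `hS` of the abstract step): for weights `w ≥ w₀ > 0`, `γ̃‖P̃u‖² ≤ ⟨P̃u, S̃(P̃u)⟩` with
`γ̃ = min(w₀, κ)(481d⁶L^{2d+4})⁻¹`, from the lower bound of (2.120) on `Ax` for the two-scale data (`P̃u` is axial).
[cite: Balaban1984PropagatorsII, (2.120)–(2.122) p.244 + p.246 (text after (2.128))] -/
theorem SbMatrix_coercive {w₀ : ℝ} (hw₀ : 0 < w₀) (hw0 : ∀ i, w₀ ≤ w i) (u : PBond P j → ℝ) :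
    min w₀ (c ^ 2 / (eta P.L j ^ P.d * ((P.L : ℝ) ^ j) ^ 2)) * (481 * (P.d : ℝ) ^ 6 * (P.L : ℝ) ^ (2 * P.d + 4))⁻¹ *
        (Matrix.of (fun x x' : PBond P j => (axial P j Λ').starProjection (EuclideanSpace.single x' (1 : ℝ)) x) *ᵥ u ⬝ᵥ
          Matrix.of (fun x x' : PBond P j => (axial P j Λ').starProjection (EuclideanSpace.single x' (1 : ℝ)) x) *ᵥ u) ≤
      Matrix.of (fun x x' : PBond P j => (axial P j Λ').starProjection (EuclideanSpace.single x' (1 : ℝ)) x) *ᵥ u ⬝ᵥ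
        Matrix.of (fun x x' : PBond P j => (tsV1 hc Λ' w).Sb (EuclideanSpace.single x' (1 : ℝ)) x) *ᵥ
          (Matrix.of (fun x x' : PBond P j => (axial P j Λ').starProjection (EuclideanSpace.single x' (1 : ℝ)) x) *ᵥ u) := by
  set k := Matrix.of (fun x x' : PBond P j => (axial P j Λ').starProjection (EuclideanSpace.single x' (1 : ℝ)) x) *ᵥ u with hk
  have hmem : WithLp.toLp 2 k ∈ (tsV1 hc Λ' w).Ax := by
    rw [hk, toLp_projAxMatrix_mulVec]
    exact Submodule.starProjection_apply_mem _ _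
  have h := inner_Sb_ge_V1 hc hj Λ' hw hw₀ hw0 ⟨WithLp.toLp 2 k, hmem⟩
  have hnorm : ‖WithLp.toLp 2 k‖ ^ 2 = k ⬝ᵥ k := by
    rw [← real_inner_self_eq_norm_sq, inner_eq_sum]
    rfl
  rw [dotProduct_siteMatrix_mulVec, ← hnorm]
  exact h

include hj hw in
/-- **THE KERNEL COLUMN OF `C̃^{(j)}_Λ` SOLVES THE COMPRESSED EQUATION**: `c = C̃^{(j)}_Λe_{b′}` satisfies `(P̃S̃P̃ + γ(1 − P̃))c = P̃e_{b′}` for every `γ`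
(`c ∈ Ax`: gen 7's `covOp_mem`; `P̃S̃c = P̃e_{b′}`: `covOp_sol` with gen 8's `Sb_pos`). [cite: Balaban1984PropagatorsII, (2.119)–(2.120) pp.243–244 + p.246 (text after (2.128))] -/
theorem covt_column_eq (γ : ℝ) (b' : PBond P j) :
    (Matrix.of (fun x x' : PBond P j => (axial P j Λ').starProjection (EuclideanSpace.single x' (1 : ℝ)) x) *
          Matrix.of (fun x x' : PBond P j => (tsV1 hc Λ' w).Sb (EuclideanSpace.single x' (1 : ℝ)) x) *
          Matrix.of (fun x x' : PBond P j => (axial P j Λ').starProjection (EuclideanSpace.single x' (1 : ℝ)) x) +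
        γ • (1 - Matrix.of (fun x x' : PBond P j => (axial P j Λ').starProjection (EuclideanSpace.single x' (1 : ℝ)) x))) *ᵥ
        (fun x => (tsV1 hc Λ' w).Ct (EuclideanSpace.single b' (1 : ℝ)) x) =
      Matrix.of (fun x x' : PBond P j => (axial P j Λ').starProjection (EuclideanSpace.single x' (1 : ℝ)) x) *ᵥ Pi.single b' 1 := by
  set Cv := (tsV1 hc Λ' w).Ct (EuclideanSpace.single b' (1 : ℝ)) with hCv
  have hCmem : Cv ∈ axial P j Λ' := covOp_mem _ _ _
  have hPl : ∀ v : PBond P j → ℝ, Matrix.of (fun x x' : PBond P j => (axial P j Λ').starProjection (EuclideanSpace.single x' (1 : ℝ)) x) *ᵥ v =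
      WithLp.ofLp ((axial P j Λ').starProjection (WithLp.toLp 2 v)) := fun v => by
    funext x
    exact siteMatrix_mulVec ((axial P j Λ').starProjection : UBond P j →ₗ[ℝ] UBond P j) v x
  have hDl : ∀ v : PBond P j → ℝ, Matrix.of (fun x x' : PBond P j => (tsV1 hc Λ' w).Sb (EuclideanSpace.single x' (1 : ℝ)) x) *ᵥ v =
      WithLp.ofLp ((tsV1 hc Λ' w).Sb (WithLp.toLp 2 v)) := fun v => by
    funext x
    exact siteMatrix_mulVec _ v x
  -- `P̃c = c`
  have h1 : Matrix.of (fun x x' : PBond P j => (axial P j Λ').starProjection (EuclideanSpace.single x' (1 : ℝ)) x) *ᵥ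
      (fun x => Cv x) = fun x => Cv x := by
    rw [hPl]
    show WithLp.ofLp ((axial P j Λ').starProjection (WithLp.toLp 2 (WithLp.ofLp Cv))) = WithLp.ofLp Cv
    rw [WithLp.toLp_ofLp, Submodule.starProjection_eq_self_iff.mpr hCmem]
  rw [compressed_mulVec_of_proj_eq _ _ γ _ h1]
  -- `P̃(S̃c) = P̃e_{b′}`: `S̃c − e_{b′} ⊥ Ax`
  have h2 : (tsV1 hc Λ' w).Sb Cv - EuclideanSpace.single b' (1 : ℝ) ∈ (axial P j Λ')ᗮ := by
    rw [Submodule.mem_orthogonal]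
    intro u hu
    rw [inner_sub_right, sub_eq_zero]
    exact covOp_sol (axial P j Λ') (tsV1 hc Λ' w).Sb
      (fun k hk => Sb_pos (isLattice Λ' hc hj hw) (positive Λ' hc hj w) k hk) ⟨u, hu⟩ _
  have h3 : (axial P j Λ').starProjection ((tsV1 hc Λ' w).Sb Cv) =
      (axial P j Λ').starProjection (EuclideanSpace.single b' (1 : ℝ)) := by
    rw [← sub_eq_zero, ← map_sub, Submodule.starProjection_apply_eq_zero_iff]
    exact h2
  rw [hDl, hPl, hPl, WithLp.toLp_ofLp, PiLp.toLp_single]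
  show WithLp.ofLp ((axial P j Λ').starProjection ((tsV1 hc Λ' w).Sb (WithLp.toLp 2 (WithLp.ofLp Cv)))) = _
  rw [WithLp.toLp_ofLp, h3]

/-! ## §2  The decay of the kernel of `C̃^{(j)}_Λ`, conditional on the Schur bound -/

include hj hw in
/-- **EXPONENTIAL DECAY OF THE KERNEL OF `C̃^{(j)}_Λ` FOR THE TWO-SCALE DATA, GIVEN THE SCHUR BOUND**: for weights `w ≥ w₀ > 0` and EVERY function
`φ` on the bonds of `T^{(j)}` such that the conjugation error of the matrix `S̃` of `Q″*aQ″ + Δ_j` under `φ` on `range P̃` is `≥ −(γ̃/2)‖P̃u‖²` (`hSe`;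
`γ̃ = min(w₀, κ)(481d⁶L^{2d+4})⁻¹`), `|⟨e_b, C̃^{(j)}_Λe_{b′}⟩| ≤ (2/γ̃)·e^{−(φ(b) − φ(b′))}` — gen 11's `…B6Cov2110CombesThomas.cov_abs_le` with §1.
[cite: Balaban1984PropagatorsII, p.246 (text after (2.128))] -/
theorem covt_kernel_decay_of_herr {w₀ : ℝ} (hw₀ : 0 < w₀) (hw0 : ∀ i, w₀ ≤ w i) (φ : PBond P j → ℝ)
    (hSe : ∀ u : PBond P j → ℝ,
      -(min w₀ (c ^ 2 / (eta P.L j ^ P.d * ((P.L : ℝ) ^ j) ^ 2)) * (481 * (P.d : ℝ) ^ 6 * (P.L : ℝ) ^ (2 * P.d + 4))⁻¹ / 2) *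
          (Matrix.of (fun x x' : PBond P j => (axial P j Λ').starProjection (EuclideanSpace.single x' (1 : ℝ)) x) *ᵥ u ⬝ᵥ
            Matrix.of (fun x x' : PBond P j => (axial P j Λ').starProjection (EuclideanSpace.single x' (1 : ℝ)) x) *ᵥ u) ≤
        ∑ a, ∑ b, (Real.exp (φ a - φ b) - 1) *
          Matrix.of (fun x x' : PBond P j => (tsV1 hc Λ' w).Sb (EuclideanSpace.single x' (1 : ℝ)) x) a b *
            ((Matrix.of (fun x x' : PBond P j => (axial P j Λ').starProjection (EuclideanSpace.single x' (1 : ℝ)) x) *ᵥ u) a *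
              (Matrix.of (fun x x' : PBond P j => (axial P j Λ').starProjection (EuclideanSpace.single x' (1 : ℝ)) x) *ᵥ u) b))
    (b b' : PBond P j) :
    |⟪EuclideanSpace.single b (1 : ℝ), (tsV1 hc Λ' w).Ct (EuclideanSpace.single b' (1 : ℝ))⟫_ℝ| ≤
      2 / (min w₀ (c ^ 2 / (eta P.L j ^ P.d * ((P.L : ℝ) ^ j) ^ 2)) * (481 * (P.d : ℝ) ^ 6 * (P.L : ℝ) ^ (2 * P.d + 4))⁻¹) *
        Real.exp (-(φ b - φ b')) := by
  have hκ0 : 0 < c ^ 2 / (eta P.L j ^ P.d * ((P.L : ℝ) ^ j) ^ 2) := B6Ineq2118TwoScaleV1.kappa_pos (P := P) hc (j := j)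
  have hΓ : 0 < (481 * (P.d : ℝ) ^ 6 * (P.L : ℝ) ^ (2 * P.d + 4))⁻¹ := by
    have hd0 : 0 < P.d := P.hd
    have := P.cast_L_pos
    positivity
  have hγ : 0 < min w₀ (c ^ 2 / (eta P.L j ^ P.d * ((P.L : ℝ) ^ j) ^ 2)) * (481 * (P.d : ℝ) ^ 6 * (P.L : ℝ) ^ (2 * P.d + 4))⁻¹ :=
    mul_pos (lt_min hw₀ hκ0) hΓ
  have h := cov_abs_le
    (Matrix.of (fun x x' : PBond P j => (axial P j Λ').starProjection (EuclideanSpace.single x' (1 : ℝ)) x))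
    (Matrix.of (fun x x' : PBond P j => (tsV1 hc Λ' w).Sb (EuclideanSpace.single x' (1 : ℝ)) x))
    (min w₀ (c ^ 2 / (eta P.L j ^ P.d * ((P.L : ℝ) ^ j) ^ 2)) * (481 * (P.d : ℝ) ^ 6 * (P.L : ℝ) ^ (2 * P.d + 4))⁻¹) φ
    (projAxMatrix_isSymm Λ') (projAxMatrix_idem Λ') (fun a b hab => projAxMatrix_blockConst hj Λ' φ a b hab) hγ
    (SbMatrix_coercive hc hj Λ' hw hw₀ hw0) hSe b b' (fun z => (tsV1 hc Λ' w).Ct (EuclideanSpace.single b' (1 : ℝ)) z)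
    (covt_column_eq hc hj Λ' hw _ b')
  rw [EuclideanSpace.inner_single_left, conj_trivial, one_mul]
  exact h

end V1

end Literature.MathematicalPhysics.QuantumFieldTheory.Balaban1983to89.B6CovTildeMatrixV1

end
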